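import Literature.MathematicalPhysics.QuantumFieldTheory.PolymerReblockingExpectation
import HarnessLib

/-!
# The shift `θ` into two-field functionals

Companion of `PolymerReblockingExpectation`. Brydges–Slade's shift operator
`θF(ζ, φ) = F(φ + ζ)` ("`θ` is the shift operator … and `(𝔼_C θ F)(φ) = 𝔼_C F(φ + ζ)`") embeds the
functionals of the total field `φ + ζ` into the `(Φ → 𝕜)`-algebra `X → X → 𝕜` of two-field
functionals on which the fluctuation integral `Fluctuation.flucExp` and the reblocking step
`PolymerActivity.rgMap` act:

* `theta`, `thetaRingHom` — `θ` is a ring homomorphism, so it passes through block products and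
  circle products (`blockProd_theta`, `thetaAct_mul`, `thetaAct_blockProd`): `θ(I^X) = (θI)^X`,
  `θ(K ∘ L) = θK ∘ θL` for the polymer-wise shift `thetaAct K`;
* `flucExp_theta` — `E(θF)(φ) = ∫ F(φ + ζ) dP(ζ)` (the Gaussian convolution `𝔼_C θ F`);
* `theta_mem_boundedMeasurable` — bounded measurable `F` give bounded measurable `θF`;
* `theta_mem_localFunctionals_restrict` — on `ℝ^ι`, if `F` is measurable and depends only on the
  coordinates in `I`, then `θF(·, φ)` is a measurable function of `ζ|_I` for every `φ` (field
  locality is inherited by the shift), which is the membership hypothesis of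
  `Fluctuation.gaussian_rgMap_union`.

## References

* D. C. Brydges, G. Slade, *A renormalisation group method. V. A single renormalisation group
  step*, J. Stat. Phys. 159 (2015) 589–667, §1.3–§1.5. arXiv:1403.7256. [BrydgesSlade2015RGV]
* G. Slade, *Critical exponents for long-range `O(n)` models below the upper critical dimension*,
  CMP 358 (2018), §4.1 (the shift `θ` and `𝔼_C θ`). [Slade2017]
-/

noncomputable section

namespace Literature.MathematicalPhysics.QuantumFieldTheory

open Finset MeasureTheory

namespace Fluctuation

variable {X : Type*} [Add X] {𝕜 : Type*}

/-! ### The shift as a ring homomorphism -/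

/-- **The shift** `θF(ζ, φ) = F(φ + ζ)` of a functional of the total field into a two-field
functional (fluctuation field first, coarse field second, as in `flucExp`).
[cite: BrydgesSlade2015RGV, §1.3] -/
def theta (F : X → 𝕜) : X → X → 𝕜 := fun ζ φ => F (φ + ζ)

/-- Unfolding `theta`. [folklore] -/
@[simp] theorem theta_apply (F : X → 𝕜) (ζ φ : X) : theta F ζ φ = F (φ + ζ) := rfl

/-- **The shift of a polymer activity**, polymer by polymer: `(θK)(Z) = θ(K(Z))`.
[cite: BrydgesSlade2015RGV, §1.5] -/
def thetaAct {Λ : Type*} (K : PolymerActivity Λ (X → 𝕜)) : PolymerActivity Λ (X → X → 𝕜) :=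
  PolymerActivity.of fun Z => theta (K Z)

/-- Unfolding `thetaAct`. [folklore] -/
@[simp] theorem thetaAct_apply {Λ : Type*} (K : PolymerActivity Λ (X → 𝕜)) (Z : Finset Λ) : thetaAct K Z = theta (K Z) := rfl

section Ring

variable [CommSemiring 𝕜]

variable (X 𝕜) in
/-- The shift is a ring homomorphism `(X → 𝕜) →+* (X → X → 𝕜)`. [folklore] -/
def thetaRingHom : (X → 𝕜) →+* (X → X → 𝕜) where
  toFun := theta
  map_one' := rfl
  map_mul' _ _ := rfl
  map_zero' := rfl
  map_add' _ _ := rfl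

/-- The underlying function of `thetaRingHom` is `theta`. [folklore] -/
theorem coe_thetaRingHom : ⇑(thetaRingHom X 𝕜) = theta := rfl

/-- `θ(FG) = θF · θG`. [folklore] -/
theorem theta_mul (F G : X → 𝕜) : theta (F * G) = theta F * theta G := rfl

/-- `θ(F + G) = θF + θG`. [folklore] -/
theorem theta_add (F G : X → 𝕜) : theta (F + G) = theta F + theta G := rfl

/-- `θ1 = 1`. [folklore] -/
theorem theta_one : theta (1 : X → 𝕜) = 1 := rfl

end Ring

section CommRing

variable [CommRing 𝕜] {Λ : Type*}

/-- **The shift passes through block products**: `(θI)^Y = θ(I^Y)`.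
[cite: BrydgesSlade2015RGV, §1.5] -/
theorem blockProd_theta (I : Λ → X → 𝕜) (Y : Finset Λ) :
    PolymerActivity.blockProd (fun B => theta (I B)) Y = theta (PolymerActivity.blockProd I Y) :=
  (PolymerActivity.map_blockProd (thetaRingHom X 𝕜) I Y).symm

/-- **The shift passes through the circle product**: `θ(K ∘ L) = θK ∘ θL`.
[cite: BrydgesSlade2015RGV, §1.5] -/
theorem thetaAct_mul [DecidableEq Λ] (K L : PolymerActivity Λ (X → 𝕜)) : thetaAct (K * L) = thetaAct K * thetaAct L := by
  ext Y
  simp only [thetaAct_apply, PolymerActivity.mul_apply, ← coe_thetaRingHom, map_sum, map_mul]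

/-- The shift of a block-factorised activity is block-factorised: `θ(I^•) = (θI)^•`.
[cite: BrydgesSlade2015RGV, §1.5] -/
theorem thetaAct_blockProd (I : Λ → X → 𝕜) :
    thetaAct (PolymerActivity.blockProd I) = PolymerActivity.blockProd (fun B => theta (I B)) := by
  ext Y
  rw [thetaAct_apply, blockProd_theta]

end CommRing

/-! ### The shift under the fluctuation integral; measurability, boundedness, locality -/

section Measure

variable [RCLike 𝕜] [MeasurableSpace X]

/-- `E(θF)(φ) = ∫ F(φ + ζ) dP(ζ)` — the Gaussian convolution `𝔼_C θ F` when `P = N(0, C)`.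
[cite: BrydgesSlade2015RGV, §1.3] -/
theorem flucExp_theta (P : Measure X) (F : X → 𝕜) : flucExp P (theta F) = fun φ => ∫ ζ, F (φ + ζ) ∂P := rfl

/-- A bounded measurable functional of the total field has a bounded measurable shift.
[folklore] -/
theorem theta_mem_boundedMeasurable [MeasurableAdd X] {F : X → 𝕜} (hFm : Measurable F) {C : ℝ}
    (hC : ∀ x, ‖F x‖ ≤ C) : theta F ∈ boundedMeasurable X X 𝕜 :=
  fun φ => ⟨hFm.comp (measurable_const_add φ), C, fun _ => hC _⟩

end Measure

section Euclidean

variable [RCLike 𝕜] {ι : Type*} [Fintype ι] [DecidableEq ι]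

/-- **Field locality is inherited by the shift.** If `F : ℝ^ι → 𝕜` is measurable and depends only
on the coordinates in `I`, then for every coarse field `φ` the shifted functional `ζ ↦ F(φ + ζ)` is a
measurable function of the restriction `ζ|_I`, i.e. `θF ∈ localFunctionals` for the restriction map
to `I` — the hypothesis on the data `δI`, `θK` in `Fluctuation.gaussian_rgMap_union`.
[cite: BrydgesSlade2015RGV, Def. 1.6.2 (field locality)] -/
theorem theta_mem_localFunctionals_restrict (I : Finset ι) {F : EuclideanSpace ℝ ι → 𝕜} (hFm : Measurable F)
    (hF : ∀ x y : EuclideanSpace ℝ ι, (∀ i ∈ I, x i = y i) → F x = F y) :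
    theta F ∈ localFunctionals (EuclideanSpace ℝ ι) 𝕜 (fun (x : EuclideanSpace ℝ ι) (i : ↥I) => x (i : ι)) := by
  intro φ
  refine ⟨fun u => F (φ + Literature.Probability.Distributions.extendByZero I u),
    hFm.comp ((Literature.Probability.Distributions.measurable_extendByZero I).const_add φ), fun ζ => ?_⟩
  show F (φ + ζ) = F (φ + Literature.Probability.Distributions.extendByZero I (fun i : ↥I => ζ (i : ι)))
  refine hF _ _ fun i hi => ?_
  have h := Literature.Probability.Distributions.extendByZero_apply_of_mem I (fun i : ↥I => ζ (i : ι)) ⟨i, hi⟩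
  simp only [PiLp.add_apply]
  rw [h]

end Euclidean

end Fluctuation

end Literature.MathematicalPhysics.QuantumFieldTheory

end
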